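import Summits.ValiantsHypothesis.ValiantsHypothesis.Theorems.FifoMatchingNCMatchings
import HarnessLib

/-!
# The noncrossing-matching sum satisfies the interval DP (support for `FifoMatching.NCInVP`, step 3)

First-arc decomposition as a sum identity: for every solution `R` of
`R i j = Σ_{i<a<j} x_{i,a} R (i+1) a R (a+1) j`, `R i i = 1`, the weighted sum over the noncrossing
matchings of `[i,j)` equals `R i j` (`sum_wt_eq`), via the bijection `M ↦ (M|inner, M|outer)`
with inverse `glue` of `FifoMatchingNCMatchings.lean`. [folklore]
-/

noncomputable section

-- layout Summits/ValiantsHypothesis/ValiantsHypothesis forces the duplicated namespace component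
set_option linter.dupNamespace false

namespace Summit.ValiantsHypothesis.ValiantsHypothesis.Theorems.FifoMatching

open MvPolynomial

universe u

variable {k : Type u} [CommSemiring k] {N : ℕ}

/-! ### The matching sum satisfies the interval DP -/

section Sum

open scoped Classical in
/-- **First-arc decomposition:** the weighted sum over the noncrossing matchings of `[i,j)` equals
every solution `R` of the interval DP `R i j = Σ_{i<a<j} x_{i,a} R (i+1) a R (a+1) j`, `R i i = 1`.
[folklore] -/
theorem sum_wt_eq (R : ℕ → ℕ → MvPolynomial (Fin N × Fin N) k)
    (xN : ℕ → ℕ → MvPolynomial (Fin N × Fin N) k)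
    (hx : ∀ (i a : ℕ) (hi : i < N) (ha : a < N), xN i a = X (⟨i, hi⟩, ⟨a, ha⟩))
    (hR0 : ∀ i j, j ≤ i → R i j = 1)
    (hR : ∀ i j, i < j → j ≤ N → R i j = ∑ a ∈ Finset.Ioo i j, xN i a * R (i + 1) a * R (a + 1) j) :
    ∀ L i j, j - i ≤ L → i ≤ j → j ≤ N →
      ∑ M ∈ Finset.univ.filter (fun M : Fin N → Fin N => IsNCOn i j M), wt k M = R i j := by
  intro L
  induction L with
  | zero =>
    intro i j hL hij hjN
    obtain rfl : i = j := by omega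
    rw [hR0 i i le_rfl]
    have hS : Finset.univ.filter (fun M : Fin N → Fin N => IsNCOn i i M) = {id} := by
      ext M
      simp only [Finset.mem_filter, Finset.mem_univ, true_and, Finset.mem_singleton]
      constructor
      · intro h; funext x; exact h.1 x (by omega)
      · rintro rfl
        exact ⟨fun x _ => rfl, fun x h1 h2 => by omega, fun p q hpq hq _ =>
          absurd (lt_trans hpq hq) (lt_irrefl _)⟩
    rw [hS, Finset.sum_singleton]
    unfold wt
    exact Finset.prod_eq_one fun x _ => by simp
  | succ L ih =>
    intro i j hL hij hjN
    rcases eq_or_lt_of_le hij with rfl | hlt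
    · exact ih i i (by omega) le_rfl hjN
    have hi : i < N := by omega
    rw [hR i j hlt hjN]
    -- split the matchings by the partner of `i`
    rw [← Finset.sum_fiberwise_of_maps_to (s := Finset.univ.filter fun M : Fin N → Fin N => IsNCOn i j M)
      (t := Finset.Ioo i j) (g := fun M => (M ⟨i, hi⟩ : ℕ)) (fun M hM => by
        rw [Finset.mem_filter] at hM
        exact Finset.mem_Ioo.mpr (partner_mem hM.2 hlt hi))]
    refine Finset.sum_congr rfl fun a ha => ?_
    rw [Finset.mem_Ioo] at ha
    have haN : a < N := by omega
    rw [hx i a hi haN, ← ih (i + 1) a (by omega) (by omega) (by omega),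
      ← ih (a + 1) j (by omega) (by omega) hjN, mul_assoc, Finset.sum_mul_sum, Finset.mul_sum]
    simp_rw [Finset.mul_sum]
    rw [← Finset.sum_product']
    -- the bijection `M ↦ (M|inner, M|outer)` with inverse `glue`
    refine Finset.sum_bij'
      (fun M _ => (restrict (i + 1) a M, restrict (a + 1) j M))
      (fun MM _ => glue ⟨i, hi⟩ ⟨a, haN⟩ MM.1 MM.2) ?_ ?_ ?_ ?_ ?_
    · intro M hM
      simp only [Finset.mem_filter, Finset.mem_univ, true_and] at hM
      obtain ⟨hM, hMa⟩ := hM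
      have hMi : M ⟨i, hi⟩ = ⟨a, haN⟩ := Fin.ext hMa
      simp only [Finset.mem_product, Finset.mem_filter, Finset.mem_univ, true_and]
      have h1 := isNCOn_restrict_inner hM hlt hi
      have h2 := isNCOn_restrict_outer hM hlt hi
      rw [hMi] at h1 h2
      exact ⟨h1, h2⟩
    · intro MM hMM
      simp only [Finset.mem_product, Finset.mem_filter, Finset.mem_univ, true_and] at hMM ⊢
      exact ⟨isNCOn_glue ha.1 ha.2 hjN hMM.1 hMM.2, by rw [glue_apply_left]⟩
    · intro M hM
      simp only [Finset.mem_filter, Finset.mem_univ, true_and] at hM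
      obtain ⟨hM, hMa⟩ := hM
      have hMi : M ⟨i, hi⟩ = ⟨a, haN⟩ := Fin.ext hMa
      have := glue_restrict hM hlt hi
      rw [hMi] at this
      exact this
    · intro MM hMM
      simp only [Finset.mem_product, Finset.mem_filter, Finset.mem_univ, true_and] at hMM
      exact Prod.ext (restrict_glue_inner ha.1 haN hMM.1) (restrict_glue_outer ha.1 ha.2 hjN hMM.2)
    · intro M hM
      simp only [Finset.mem_filter, Finset.mem_univ, true_and] at hM
      obtain ⟨hM, hMa⟩ := hM
      have hMi : M ⟨i, hi⟩ = ⟨a, haN⟩ := Fin.ext hMa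
      have := wt_eq_mul (k := k) hM hlt hi
      rw [hMi] at this
      rw [this]
      ring

end Sum

end Summit.ValiantsHypothesis.ValiantsHypothesis.Theorems.FifoMatching

end
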